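import Summits.QuantumFields.YangMills.Theorems.BalabanUVNodesN18StationaryKernelOfKernelLettersCorner
import Summits.QuantumFields.YangMills.Theorems.BalabanUVNodesN18RunningBetaLettersModelNodes

/-!
# BalabanUVNodes ∕ N18 — THE STATIONARY KERNEL, FILE 4: A6 MODEL INHABITANT WITH GENUINE MEMORY.  At dag-n18-w2's FADING TWO-BOND TERM FAMILY `crossTermFamily F (fadingLaw ω) e`
# (`…N18RunningBetaLettersModelNodes` p613743: a scalar term family whose (1.22) β RUNS with every past coupling, with ALL of W1-19b's letters, node N18's `KernelStepRate`, kernel NE9 +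
# fading memory and the (5.10) class PROVED there, model level) EVERY HYPOTHESIS of FILES 1–2 HOLDS BY NAME, and the conclusions are EXPLICIT: the stationary kernel is
# `Π_∞(h) = crossKernel (expAvg ω ω h) e` — P1's exponentially weighted history average `expAvg ω ω h = ω·Σ'_j ω^j h j` ([T4BetaStationary] §7's probe) as the amplitude —, node U2's
# functional of the model's β is `betaInf (fadingLaw ω) h = expAvg ω ω h` (times `e₀e₁`), (1.22) AT LEVEL ∞ holds NON-VACUOUSLY with both sides computed, the stationary kernel has GENUINE
# memory (it separates constant histories), and at the UV corner the model sits EXACTLY on the boundary `c_∞ = 0` of idea-7's §6 (corner kernels and corner limit number vanish)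
# (Track A, DAG node N18 = NE5; cluster K4 «SpineRates»; key K3⁷ `SpineGivenEndpointR13SepCoPH` = stmt-QuantumFields-20544, skeleton v5 941dddb108cbaacf; width seat `pub-ymgap-dag-n18-w1` g5,
# FILE 4 of the g5 series — FILE 1 `…N18StationaryKernelOfKernelLetters` p620457, FILE 2 `…Corner`, FILE 3 `…Rows`)

HONEST FRAMING.  Count-neutral MODEL-LEVEL bookkeeping BY NAME (`--kind proof --supports stmt-QuantumFields-20544 --as helper`): an A6 inhabitant (chair №189: a hypothesis-form theorem
whose antecedent is uninhabited is vacuous — here every antecedent of FILES 1–2 is inhabited at once, by a family that is NOT Bałaban's).  Inputs cited by name: dag-n18-w2's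
`crossTermFamily ∕ crossKernel ∕ kernelA_crossTermFamily ∕ betaMerged_crossTermFamily ∕ fadingLaw ∕ fadingAmp ∕ kernelStepRate_fadingCross ∕ ne9_EA_fadingCross ∕ kernelDecay_fadingCross ∕
crossLetters ∕ crossLetters_moduli`, P1's `expAvg ∕ summable_weighted ∕ SeqBox ∕ revHist ∕ betaInf ∕ sum_fin_eq_sum_range_age`, FILES 1–2.  NOTHING of Bałaban's
merged term (1.6) is modelled or asserted; the model's couplings, bonds and amplitudes are arbitrary real numbers; NO letter OF RECORD is inhabited; N17 ∕ N18 ∕ N22 NOT discharged; K3⁷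
OPEN, `stub_rates13H` ∕ `stub_expansion13H` NOT proved; K2's one bit untouched (the model's corner number is `0`, neither sign).  Counts UNMOVED (typed 28∕28 · discharged 5∕27,
A 5∕28).  One finite four-torus programme at fixed `ε`, Bałaban AS PRINTED; route R4 closes ONLY the conditional finite-𝕋⁴ rung `BalabanLadder.UV` — NOT the continuum limit, NOT
ℝ⁴, NOT OS, NOT the Yang–Mills mass gap, NOT Clay.  THEOREMS ONLY: 0 `def`, 0 `instance`, 0 `sorry`, standard axioms.

WHAT (theorems only; `ρ = id`, `bV = Module.Basis.singleton Unit ℝ` as in dag-n18-w2's model).  §9a the fading law along reversed histories: `fadingAmp_revHist_eq_sum_range`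
(`fadingAmp ω k (revHist h k) = Σ_{j ≤ k} ω^{j+1} h j` — age reindexing) · `tendsto_fadingAmp_revHist` (`→ expAvg ω ω h` for `SeqBox γ h`, `0 ≤ ω < 1`) · ★ `betaInf_fadingLaw` (`betaInf (fadingLaw ω) h =
expAvg ω ω h` — node U2's functional of dag-n18-w2's running law IS P1's probe).  §9b the stationary kernel of the model: `kernelA_fadingCross_revHist` · `tendsto_crossKernel` · ★★ `stationaryKernel_fadingCross_eq`
(FILE 1's canonical stationary kernel `betaInf (entry μ ν z) h` EQUALS `crossKernel (expAvg ω ω h) e μ ν z` — FILE 1's `tendsto_kernelEntry_revHist_stationary` with the model's PROVED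
`KernelStepRate` against the explicit limit, uniqueness) · ★ `betaInf_betaMerged_fadingCross` ((1.22) AT LEVEL ∞, NON-VACUOUSLY: FILE 1's `betaInf_betaMerged_eq_secondMoment_stationaryKernel`
APPLIES — its five hypotheses discharged by dag-n18-w2's model theorems) · `betaInf_betaMerged_fadingCross_eq_expAvg` (the left-hand side computed: `expAvg ω ω h · e₀e₁`) · `memoryProfile_fadingCross`
(FILE 1 §3 applies: profile constant `e^{−κ|z|₁}·wt κ e·ω`, any `κ`) · ★ `stationaryKernel_fadingCross_const` + `stationaryKernel_fadingCross_separates` (GENUINE MEMORY: at constant histories `t`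
the stationary kernel is `crossKernel (ω t (1−ω)⁻¹) e`, so two constant histories `t ≠ t'` give DIFFERENT stationary kernels at `(0,1,e)` when `ω ≠ 0`).  §9c the UV corner of the model:
`cornerKernels_fadingCross_eq_zero` (the corner kernels of FILE 2's hypothesis form are `0`: `Π_{k+1}(t,…,t) = crossKernel ((Σ_{i≤k} ω^{k+1−i})·t) e → 0` as `t → 0⁺`) · ★ `tendsto_betaInf_betaMerged_fadingCross_corner`
(FILE 2's `tendsto_betaInf_betaMerged_const_of_cornerNumbers` APPLIES with `c_k = 0`, `c_∞ = 0`: the model's continuum functional tends to `0` at the UV corner — idea-7 §6's boundary case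
`L_∞ = 0`, where the kernel letters decide nothing about K2's bit).

References (TYPES ∕ locators only): [Balaban1987RG1] CMP **109** (1987): p. 255 (one β-function: motivation only), Thm 1 p. 259, (1.20)–(1.22) p. 264, (2.13) p. 268, (5.10) p. 293;
[Balaban1988RG2Cluster] CMP **116** (1988) (2.13) p. 14 (the history-dependent terms the model caricatures).
-/

noncomputable section

open Filter Topology
open scoped BigOperators

namespace YMDAG.N18.StationaryKernelOfKernelLetters

open Literature.MathematicalPhysics.QuantumFieldTheory.Balaban1983to89
open Literature.MathematicalPhysics.QuantumFieldTheory.Balaban1983to89.T4Continuum (T4Family)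
open Literature.MathematicalPhysics.QuantumFieldTheory.Balaban1983to89.T4OutputRate (Window NE9)
open Literature.MathematicalPhysics.QuantumFieldTheory.Balaban1983to89.FlowStep (Box HBeta mem_box)
open Literature.MathematicalPhysics.QuantumFieldTheory.Balaban1983to89.B12Beta (secondMoment)
open Literature.MathematicalPhysics.QuantumFieldTheory.Balaban1983to89.T4CouplingMatching (FadingMemory)
open Literature.MathematicalPhysics.QuantumFieldTheory.Balaban1983to89.T4FlagMemory (extd)
open Literature.MathematicalPhysics.QuantumFieldTheory.Balaban1983to89.T4BetaStationary (SeqBox revHist betaInf MemoryProfile revHist_mem_box sum_fin_eq_sum_range_age)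
open Literature.MathematicalPhysics.QuantumFieldTheory.Balaban1983to89.T4BetaStationary.Probes (expAvg summable_weighted)
open Literature.MathematicalPhysics.QuantumFieldTheory.Balaban1983to89.Node00 (TermFamily1 betaMerged)
open Literature.MathematicalPhysics.QuantumFieldTheory.Balaban1983to89.Node00.U3OfKernels (kernelA EA KernelDecay histPrefix_extd)
open Literature.MathematicalPhysics.QuantumFieldTheory.Balaban1983to89.Node00.U3KernelLetters (KernelStepRate)
open Literature.MathematicalPhysics.QuantumFieldTheory.Balaban1983to89.B12Sec2to5 (l1 Decay510)
open YMDAG.N18.FiniteVolumeLettersModel (fadingAmp)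
open YMDAG.N18.RunningBetaLettersModel (crossKernel crossTermFamily wt fadingLaw crossLetters kernelA_crossTermFamily betaMerged_crossTermFamily crossKernel_zero_one
  kernelStepRate_fadingCross ne9_EA_fadingCross kernelDecay_fadingCross crossLetters_moduli fadingLaw_apply)
open YMDAG.N18.CornerKernelsOfKernelLetters (extd_const)

variable (F : T4Family)

/-! ## §9a The fading law along reversed histories: node U2's functional of dag-n18-w2's running law IS P1's exponentially weighted average -/

/-- Along the prefixes of a reversed history the fading amplitude is the age sum `Σ_{j ≤ k} ω^{j+1} h j` (position `i` has age `k − i` and weight `ω^{k+1−i} = ω^{age+1}`).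
[folklore] -/
theorem fadingAmp_revHist_eq_sum_range (ω : ℝ) (h : ℕ → ℝ) (k : ℕ) :
    fadingAmp ω k (revHist h k) = ∑ j ∈ Finset.range (k + 1), ω ^ (j + 1) * h j := by
  unfold fadingAmp
  rw [← sum_fin_eq_sum_range_age (fun j => ω ^ (j + 1) * h j) k]
  refine Finset.sum_congr rfl fun i _ => ?_
  have hik : (i : ℕ) ≤ k := Nat.lt_succ_iff.mp i.2
  show ω ^ (k + 1 - (i : ℕ)) * revHist h k i = ω ^ (k - (i : ℕ) + 1) * h (k - (i : ℕ))
  rw [T4BetaStationary.revHist_apply, show k + 1 - (i : ℕ) = k - (i : ℕ) + 1 by omega]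

/-- For a box-valued reversed history (`0 ≤ ω < 1`) the fading amplitudes along its prefixes converge to `expAvg ω ω h = ω·Σ'_j ω^j h j`. [folklore] -/
theorem tendsto_fadingAmp_revHist {ω γ : ℝ} (hω0 : 0 ≤ ω) (hω1 : ω < 1) {h : ℕ → ℝ} (hh : SeqBox γ h) :
    Tendsto (fun k : ℕ => fadingAmp ω k (revHist h k)) atTop (𝓝 (expAvg ω ω h)) := by
  have hs := summable_weighted hω0 hω1 hh
  have ht : Tendsto (fun k : ℕ => ∑ j ∈ Finset.range (k + 1), ω ^ j * h j) atTop (𝓝 (∑' j, ω ^ j * h j)) :=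
    (hs.hasSum.tendsto_sum_nat).comp (tendsto_add_atTop_nat 1)
  have e : (fun k : ℕ => fadingAmp ω k (revHist h k)) = fun k => ω * ∑ j ∈ Finset.range (k + 1), ω ^ j * h j := by
    funext k
    rw [fadingAmp_revHist_eq_sum_range, Finset.mul_sum]
    exact Finset.sum_congr rfl fun j _ => by ring
  rw [e]
  exact ht.const_mul ω

/-- ★ **node U2's CONTINUUM FUNCTIONAL OF dag-n18-w2's RUNNING LAW IS P1's PROBE**: `betaInf (fadingLaw ω) h = expAvg ω ω h` on box-valued histories. [folklore] -/
theorem betaInf_fadingLaw {ω γ : ℝ} (hω0 : 0 ≤ ω) (hω1 : ω < 1) {h : ℕ → ℝ} (hh : SeqBox γ h) : betaInf (fadingLaw ω) h = expAvg ω ω h :=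
  (tendsto_fadingAmp_revHist hω0 hω1 hh).limUnder_eq

/-! ## §9b The stationary kernel of the fading two-bond model, EXPLICITLY; FILES 1–2 hold non-vacuously -/

/-- The model's level-`(k+1)` kernel along a reversed history: `crossKernel (fadingAmp ω k (revHist h k)) e`. [cite: Balaban1987RG1, (1.21) p.264; model] -/
theorem kernelA_fadingCross_revHist (ω : ℝ) (e : Fin 4 → ℤ) (h : ℕ → ℝ) (k : ℕ) (μ ν : Fin 4) (z : Fin 4 → ℤ) :
    kernelA F (crossTermFamily F (fadingLaw ω) e) (ContinuousLinearMap.id ℝ ℝ) (Module.Basis.singleton Unit ℝ) (extd (revHist h k)) k μ ν z =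
      crossKernel (fadingAmp ω k (revHist h k)) e μ ν z := by
  rw [kernelA_crossTermFamily, histPrefix_extd, fadingLaw_apply]

/-- The closed-form kernel is continuous (indeed linear) in its amplitude. [folklore] -/
theorem tendsto_crossKernel {c : ℕ → ℝ} {cinf : ℝ} (hc : Tendsto c atTop (𝓝 cinf)) (e : Fin 4 → ℤ) (μ ν : Fin 4) (z : Fin 4 → ℤ) :
    Tendsto (fun k : ℕ => crossKernel (c k) e μ ν z) atTop (𝓝 (crossKernel cinf e μ ν z)) := by
  unfold crossKernel
  exact hc.mul_const _

/-- ★★ **THE STATIONARY KERNEL OF THE MODEL IS `crossKernel (expAvg ω ω h) e`** (`0 ≤ ω < 1`, `SeqBox γ h`): FILE 1's canonical stationary kernel — the limit `betaInf (entry μ ν z) h` whose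
existence FILE 1 derives from node N18's `KernelStepRate`, here dag-n18-w2's PROVED `kernelStepRate_fadingCross` — coincides with the explicit limit of the model's kernels (uniqueness of
limits).  MODEL LEVEL; nothing of Bałaban's. [cite: Balaban1987RG1, (1.21) p.264 and Thm 1 p.259; model] -/
theorem stationaryKernel_fadingCross_eq {ω γ : ℝ} (hω0 : 0 ≤ ω) (hω1 : ω < 1) (e : Fin 4 → ℤ) (κ : ℝ) {h : ℕ → ℝ} (hh : SeqBox γ h) (μ ν : Fin 4) (z : Fin 4 → ℤ) :
    betaInf (fun k v => kernelA F (crossTermFamily F (fadingLaw ω) e) (ContinuousLinearMap.id ℝ ℝ) (Module.Basis.singleton Unit ℝ) (extd v) k μ ν z) h =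
      crossKernel (expAvg ω ω h) e μ ν z := by
  have h1 := tendsto_kernelEntry_revHist_stationary F (crossTermFamily F (fadingLaw ω) e) (ContinuousLinearMap.id ℝ ℝ) (Module.Basis.singleton Unit ℝ)
    (kernelStepRate_fadingCross F hω0 γ e κ) hω1 hh μ ν z
  have h2 : Tendsto (fun k : ℕ => kernelA F (crossTermFamily F (fadingLaw ω) e) (ContinuousLinearMap.id ℝ ℝ) (Module.Basis.singleton Unit ℝ) (extd (revHist h k)) k μ ν z)
      atTop (𝓝 (crossKernel (expAvg ω ω h) e μ ν z)) := by
    simp only [kernelA_fadingCross_revHist]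
    exact tendsto_crossKernel (tendsto_fadingAmp_revHist hω0 hω1 hh) e μ ν z
  exact tendsto_nhds_unique h1 h2

/-- ★ **(1.22) AT LEVEL ∞ HOLDS NON-VACUOUSLY**: FILE 1's `betaInf_betaMerged_eq_secondMoment_stationaryKernel` APPLIES to the fading two-bond model — its hypotheses `0 < κ`,
`KernelStepRate`, `0 ≤ ω < 1`, the (5.10) clause on the window are dag-n18-w2's PROVED model theorems — and, with both sides computed, reads
`betaInf (fadingLaw ω · e₀e₁) h = secondMoment (crossKernel (expAvg ω ω h) e) 0 1`.  MODEL LEVEL. [cite: Balaban1987RG1, (1.22) p.264; model] -/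
theorem betaInf_betaMerged_fadingCross {ω γ κ : ℝ} (hκ : 0 < κ) (hω0 : 0 ≤ ω) (hω1 : ω < 1) (e : Fin 4 → ℤ) {h : ℕ → ℝ} (hh : SeqBox γ h) :
    betaInf (betaMerged F (crossTermFamily F (fadingLaw ω) e) (ContinuousLinearMap.id ℝ ℝ) (Module.Basis.singleton Unit ℝ)) h =
      secondMoment (crossKernel (expAvg ω ω h) e) 0 1 := by
  have key := betaInf_betaMerged_eq_secondMoment_stationaryKernel F (crossTermFamily F (fadingLaw ω) e) (ContinuousLinearMap.id ℝ ℝ) (Module.Basis.singleton Unit ℝ)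
    hκ (kernelStepRate_fadingCross F hω0 γ e κ) hω0 hω1 (kernelDecay_fadingCross F hω0 hω1 γ e 0 1 κ) hh
  rw [key]
  congr 1
  funext μ ν z
  exact stationaryKernel_fadingCross_eq F hω0 hω1 e κ hh μ ν z

/-- … and the left-hand side is P1's probe times `e₀e₁`: `betaInf (betaMerged …) h = expAvg ω ω h · (e₀·e₁)` (dag-n18-w2's closed-form β + §9a). [cite: Balaban1987RG1, (1.22) p.264; model] -/
theorem betaInf_betaMerged_fadingCross_eq_expAvg {ω γ : ℝ} (hω0 : 0 ≤ ω) (hω1 : ω < 1) (e : Fin 4 → ℤ) {h : ℕ → ℝ} (hh : SeqBox γ h) :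
    betaInf (betaMerged F (crossTermFamily F (fadingLaw ω) e) (ContinuousLinearMap.id ℝ ℝ) (Module.Basis.singleton Unit ℝ)) h = expAvg ω ω h * ((e 0 : ℝ) * e 1) := by
  rw [betaMerged_crossTermFamily]
  have ht : Tendsto (fun k : ℕ => fadingLaw ω k (revHist h k) * ((e 0 : ℝ) * e 1)) atTop (𝓝 (expAvg ω ω h * ((e 0 : ℝ) * e 1))) :=
    (tendsto_fadingAmp_revHist hω0 hω1 hh).mul_const _
  exact ht.limUnder_eq

/-- **FILE 1 §3 APPLIES**: the model's stationary kernel has the memory profile with constant `e^{−κ|z|₁}·wt κ e·ω` and ratio `ω` (dag-n18-w2's kernel NE9 with the block's moduli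
`wt·ω^{n−i}`, which ARE a fading-memory profile). MODEL LEVEL. [cite: Balaban1987RG1, §5 p.298; model] -/
theorem memoryProfile_fadingCross {ω γ : ℝ} (κ : ℝ) (hω0 : 0 < ω) (hω1 : ω < 1) (e : Fin 4 → ℤ) (μ ν : Fin 4) (z : Fin 4 → ℤ) :
    MemoryProfile (Real.exp (-(κ * l1 z)) * wt κ e * ω) ω γ
      (betaInf (fun k v => kernelA F (crossTermFamily F (fadingLaw ω) e) (ContinuousLinearMap.id ℝ ℝ) (Module.Basis.singleton Unit ℝ) (extd v) k μ ν z)) := by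
  have hF : T4OutputRate.FadingMemory (wt κ e) ω (crossLetters γ ω κ e).moduli := fun a i _ => by
    rw [crossLetters_moduli]
    exact ⟨mul_nonneg (YMDAG.N18.RunningBetaLettersModel.wt_nonneg κ e) (pow_nonneg hω0.le _), le_rfl⟩
  exact memoryProfile_stationaryKernel_of_ne9 F (crossTermFamily F (fadingLaw ω) e) (ContinuousLinearMap.id ℝ ℝ) (Module.Basis.singleton Unit ℝ)
    (kernelStepRate_fadingCross F hω0.le γ e κ) hω1 (ne9_EA_fadingCross F hω0.le γ e κ) hF hω0.le hω1 μ ν z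

/-- ★ **AT A CONSTANT HISTORY `t` THE STATIONARY KERNEL IS `crossKernel (ω·t·(1−ω)⁻¹) e`** (the geometric series). MODEL LEVEL. [folklore] -/
theorem stationaryKernel_fadingCross_const {ω γ t : ℝ} (hω0 : 0 ≤ ω) (hω1 : ω < 1) (ht : t ∈ Set.Ioc 0 γ) (e : Fin 4 → ℤ) (κ : ℝ) (μ ν : Fin 4) (z : Fin 4 → ℤ) :
    betaInf (fun k v => kernelA F (crossTermFamily F (fadingLaw ω) e) (ContinuousLinearMap.id ℝ ℝ) (Module.Basis.singleton Unit ℝ) (extd v) k μ ν z) (fun _ : ℕ => t) =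
      crossKernel (ω * t * (1 - ω)⁻¹) e μ ν z := by
  have hh : SeqBox γ (fun _ : ℕ => t) := fun _ => ht
  rw [stationaryKernel_fadingCross_eq F hω0 hω1 e κ hh]
  congr 1
  show ω * ∑' j : ℕ, ω ^ j * t = _
  rw [tsum_mul_right, tsum_geometric_of_lt_one hω0 hω1]
  ring

/-- ★ **GENUINE MEMORY**: for `ω ≠ 0` two DIFFERENT constant box histories `t ≠ t'` have DIFFERENT stationary kernels at the mixed entry `(0, 1, e)` — FILE 1's stationary kernel functional is
NOT constant on the box-valued histories in this model (contrast: a coupling-blind term family has a constant one). MODEL LEVEL. [folklore] -/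
theorem stationaryKernel_fadingCross_separates {ω γ t t' : ℝ} (hω0 : 0 < ω) (hω1 : ω < 1) (ht : t ∈ Set.Ioc 0 γ) (ht' : t' ∈ Set.Ioc 0 γ) (htt' : t ≠ t')
    (e : Fin 4 → ℤ) (κ : ℝ) :
    betaInf (fun k v => kernelA F (crossTermFamily F (fadingLaw ω) e) (ContinuousLinearMap.id ℝ ℝ) (Module.Basis.singleton Unit ℝ) (extd v) k 0 1 e) (fun _ : ℕ => t) ≠
      betaInf (fun k v => kernelA F (crossTermFamily F (fadingLaw ω) e) (ContinuousLinearMap.id ℝ ℝ) (Module.Basis.singleton Unit ℝ) (extd v) k 0 1 e) (fun _ : ℕ => t') := by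
  rw [stationaryKernel_fadingCross_const F hω0.le hω1 ht e κ, stationaryKernel_fadingCross_const F hω0.le hω1 ht' e κ, crossKernel_zero_one, crossKernel_zero_one,
    if_pos rfl, if_pos rfl]
  intro hc
  have h1 : (1 - ω)⁻¹ ≠ 0 := inv_ne_zero (sub_ne_zero.2 (ne_of_gt hω1))
  exact htt' (mul_left_cancel₀ hω0.ne' (mul_right_cancel₀ h1 hc))

/-! ## §9c The UV corner of the model: corner kernels and corner limit number VANISH — idea-7 §6's boundary case `c_∞ = 0` -/

/-- On the diagonal `(t,…,t)` the model's level-`(k+1)` kernel is `crossKernel (fadingAmp ω k (t,…,t)) e` and tends to the ZERO kernel as `t → 0⁺` (each amplitude is `t` times a finite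
geometric sum). MODEL LEVEL. [folklore] -/
theorem cornerKernels_fadingCross_eq_zero (ω : ℝ) (e : Fin 4 → ℤ) (k : ℕ) (μ ν : Fin 4) (z : Fin 4 → ℤ) :
    Tendsto (fun t : ℝ => kernelA F (crossTermFamily F (fadingLaw ω) e) (ContinuousLinearMap.id ℝ ℝ) (Module.Basis.singleton Unit ℝ) (fun _ : ℕ => t) k μ ν z)
      (𝓝[>] (0 : ℝ)) (𝓝 0) := by
  have e1 : ∀ t : ℝ, kernelA F (crossTermFamily F (fadingLaw ω) e) (ContinuousLinearMap.id ℝ ℝ) (Module.Basis.singleton Unit ℝ) (fun _ : ℕ => t) k μ ν z =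
      crossKernel ((∑ i : Fin (k + 1), ω ^ (k + 1 - (i : ℕ))) * t) e μ ν z := fun t => by
    rw [kernelA_crossTermFamily, fadingLaw_apply]
    unfold fadingAmp
    simp only [Node00.U3OfKernels.histPrefix_apply, Finset.sum_mul]
  simp only [e1]
  have hcont : Continuous (fun t : ℝ => crossKernel ((∑ i : Fin (k + 1), ω ^ (k + 1 - (i : ℕ))) * t) e μ ν z) := by
    unfold crossKernel
    fun_prop
  have h := hcont.tendsto 0
  have h00 : crossKernel ((∑ i : Fin (k + 1), ω ^ (k + 1 - (i : ℕ))) * 0) e μ ν z = 0 := by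
    unfold crossKernel
    ring
  rw [h00] at h
  exact h.mono_left nhdsWithin_le_nhds

/-- ★ **AT THE UV CORNER THE MODEL's CONTINUUM FUNCTIONAL TENDS TO `0`**: FILE 2's `tendsto_betaInf_betaMerged_const_of_cornerNumbers` APPLIES (every hypothesis a PROVED model theorem of
dag-n18-w2; corner numbers `c_k = 0` — the model's β `fadingAmp ω k (t,…,t)·e₀e₁` vanishes as `t → 0⁺` —, `c_∞ = 0`), giving `betaInf (betaMerged …)(t,t,…) → 0` as `t → 0⁺`: the model realises
EXACTLY idea-7 §6's boundary case `L_∞ = 0` (the three kernel letters hold, the UV corner value is `0`, K2's strict bit is neither confirmed nor refuted). MODEL LEVEL; nothing of Bałaban's.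
[cite: Balaban1987RG1, (1.22) p.264 and (2.13) p.268; model] -/
theorem tendsto_betaInf_betaMerged_fadingCross_corner {ω γ κ : ℝ} (hγ : 0 < γ) (hκ : 0 < κ) (hω0 : 0 < ω) (hω1 : ω < 1) (e : Fin 4 → ℤ) :
    Tendsto (fun t : ℝ => betaInf (betaMerged F (crossTermFamily F (fadingLaw ω) e) (ContinuousLinearMap.id ℝ ℝ) (Module.Basis.singleton Unit ℝ)) (fun _ : ℕ => t))
      (𝓝[>] (0 : ℝ)) (𝓝 0) := by
  have hF : T4OutputRate.FadingMemory (wt κ e) ω (crossLetters γ ω κ e).moduli := fun a i _ => by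
    rw [crossLetters_moduli]
    exact ⟨mul_nonneg (YMDAG.N18.RunningBetaLettersModel.wt_nonneg κ e) (pow_nonneg hω0.le _), le_rfl⟩
  -- the corner numbers of the model vanish: `β_{k+1}(t,…,t) = fadingAmp ω k (t,…,t)·e₀e₁ → 0`
  have hc : ∀ k : ℕ, Tendsto (fun t : ℝ => betaMerged F (crossTermFamily F (fadingLaw ω) e) (ContinuousLinearMap.id ℝ ℝ) (Module.Basis.singleton Unit ℝ) k
      (fun _ : Fin (k + 1) => t)) (𝓝[>] (0 : ℝ)) (𝓝 ((fun _ : ℕ => (0 : ℝ)) k)) := fun k => by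
    rw [betaMerged_crossTermFamily]
    have e1 : ∀ t : ℝ, fadingLaw ω k (fun _ : Fin (k + 1) => t) * ((e 0 : ℝ) * e 1) = (∑ i : Fin (k + 1), ω ^ (k + 1 - (i : ℕ))) * ((e 0 : ℝ) * e 1) * t := fun t => by
      rw [fadingLaw_apply]
      unfold fadingAmp
      rw [Finset.sum_mul, Finset.sum_mul, Finset.sum_mul]
      exact Finset.sum_congr rfl fun i _ => by ring
    simp only [e1]
    have h : Tendsto (fun t : ℝ => (∑ i : Fin (k + 1), ω ^ (k + 1 - (i : ℕ))) * ((e 0 : ℝ) * e 1) * t) (𝓝 (0 : ℝ))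
        (𝓝 ((∑ i : Fin (k + 1), ω ^ (k + 1 - (i : ℕ))) * ((e 0 : ℝ) * e 1) * 0)) := (continuous_const.mul continuous_id).tendsto 0
    rw [mul_zero] at h
    exact h.mono_left nhdsWithin_le_nhds
  exact tendsto_betaInf_betaMerged_const_of_cornerNumbers F (crossTermFamily F (fadingLaw ω) e) (ContinuousLinearMap.id ℝ ℝ) (Module.Basis.singleton Unit ℝ)
    hγ hκ (ne9_EA_fadingCross F hω0.le γ e κ) hF hω0.le hω1 (kernelStepRate_fadingCross F hω0.le γ e κ) hω0.le hω1 (kernelDecay_fadingCross F hω0.le hω1 γ e 0 1 κ)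
    (c := fun _ : ℕ => (0 : ℝ)) (cinf := 0) hc tendsto_const_nhds

end YMDAG.N18.StationaryKernelOfKernelLetters

end
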